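import Literature.NumberTheory.EllipticCurves.PAdicMeasureTwistedMomentsProofs
import HarnessLib

/-!
# The inverted distribution `μ̌(u) = μ(u⁻¹)` of a bounded distribution on `ℤ_p^×`

Lang, *Cyclotomic Fields I and II*, Ch. 4 §2 ("Operations on measures and power series", PDF
pp. 80–82) transports measures on `ℤ_p` / `ℤ_p^*` along maps of the group; the Mellin transform of
§3 is `∫ ⟨a⟩^s χ(a) a⁻¹ dE_{1,c}(a)`.  For the tree's `p`-adic Mellin transform
(`PAdicMeasureTransform`: `L_μ(T) = ∫_{ℤ_p^×} (1+T)^{ℓ(x)} dμ(x)`) the change of variables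
`x ↦ x⁻¹` turns the value at `T = γ^{j} − 1` into the value at `T = γ^{-j} − 1`
(`PAdicMeasureTwistedMomentsProofs.hasSum_coeff_mul_cyclotomicGenerator_inv_pow_sub_one_of_twist`).
This file constructs the inverted distribution concretely:

* `invUnitsDist μ n a = μ n a⁻¹` for a unit class `a`, `0` otherwise;
* `norm_invUnitsDist_le` — it is bounded by the bound of `μ`;
* `invUnitsDist_distribution` — it satisfies the distribution relation when `μ` does and `μ`
  vanishes on the non-unit classes of positive level (a measure on `ℤ_p^×`);
* `invUnitsDist_classMap` — on the classes `η γ^s mod p^{n+e₀}`: `μ̌(ηγ^s) = μ(η⁻¹γ^{-s})`.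

Everything is proved; there are no named facts.

## References

* S. Lang, *Cyclotomic Fields I and II*, GTM 121, Springer 1990, Ch. 4 §2 (PDF pp. 80–82).
  [LangCyclotomic1990]
-/

noncomputable section

open scoped Classical

open Filter Topology

namespace Literature.NumberTheory.EllipticCurves

variable {p : ℕ} [Fact p.Prime]

/-- **The inverted distribution `μ̌`** of a distribution `μ` on `ℤ_p` supported on the units:
`μ̌(a + p^nℤ_p) = μ(a⁻¹ + p^nℤ_p)` for `a` a unit modulo `p^n`, and `0` on the non-unit classes
(the push-forward of `μ|_{ℤ_p^×}` along `x ↦ x⁻¹`; Lang Ch. 4 §2, operations on measures).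
[cite: LangCyclotomic1990, Ch. 4 §2 (operations on measures, PDF pp. 80–82)] -/
def invUnitsDist (μ : (n : ℕ) → ZMod (p ^ n) → ℚ_[p]) (n : ℕ) (a : ZMod (p ^ n)) : ℚ_[p] :=
  if h : IsUnit a then μ n ((h.unit⁻¹ : (ZMod (p ^ n))ˣ) : ZMod (p ^ n)) else 0

variable {μ : (n : ℕ) → ZMod (p ^ n) → ℚ_[p]}

/-- `μ̌` is bounded by any nonnegative bound of `μ`.
[cite: LangCyclotomic1990, Ch. 4 §2 (operations on measures, PDF pp. 80–82)] -/
theorem norm_invUnitsDist_le {C : ℝ} (hC : ∀ (n : ℕ) (a : ZMod (p ^ n)), ‖μ n a‖ ≤ C) (n : ℕ)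
    (a : ZMod (p ^ n)) : ‖invUnitsDist μ n a‖ ≤ C := by
  unfold invUnitsDist
  split_ifs with h
  · exact hC n _
  · rw [norm_zero]; exact (norm_nonneg _).trans (hC 0 0)

/-! ### The involution `σ(a) = a⁻¹` on units, `σ(a) = a` on non-units -/

/-- `σ(a) = a⁻¹` for a unit `a`, `σ(a) = a` otherwise. [folklore] -/
private def unitInv {m : ℕ} (a : ZMod m) : ZMod m :=
  if h : IsUnit a then ((h.unit⁻¹ : (ZMod m)ˣ) : ZMod m) else a

omit [Fact p.Prime] in
/-- `σ(a) = a⁻¹` on units. [folklore] -/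
private theorem unitInv_of_isUnit {m : ℕ} {a : ZMod m} (h : IsUnit a) :
    unitInv a = ((h.unit⁻¹ : (ZMod m)ˣ) : ZMod m) := by
  rw [unitInv, dif_pos h]

omit [Fact p.Prime] in
/-- `σ(a) = a` on non-units. [folklore] -/
private theorem unitInv_of_not_isUnit {m : ℕ} {a : ZMod m} (h : ¬ IsUnit a) : unitInv a = a := by
  rw [unitInv, dif_neg h]

omit [Fact p.Prime] in
/-- `σ(u) = u⁻¹` for `u : (ℤ/m)ˣ`. [folklore] -/
private theorem unitInv_coe_unit {m : ℕ} (u : (ZMod m)ˣ) :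
    unitInv (u : ZMod m) = ((u⁻¹ : (ZMod m)ˣ) : ZMod m) := by
  rw [unitInv_of_isUnit u.isUnit, IsUnit.unit_of_val_units]

omit [Fact p.Prime] in
/-- `σ` is an involution. [folklore] -/
private theorem unitInv_unitInv {m : ℕ} (a : ZMod m) : unitInv (unitInv a) = a := by
  by_cases h : IsUnit a
  · rw [unitInv_of_isUnit h, unitInv_coe_unit, inv_inv, IsUnit.unit_spec]
  · rw [unitInv_of_not_isUnit h, unitInv_of_not_isUnit h]

/-- With `μ` vanishing on the non-unit classes of positive level, `μ̌ = μ ∘ σ` at every level.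
[folklore] -/
private theorem invUnitsDist_eq_comp
    (h0 : ∀ n : ℕ, 1 ≤ n → ∀ a : ZMod (p ^ n), ¬ IsUnit a → μ n a = 0) (n : ℕ)
    (a : ZMod (p ^ n)) : invUnitsDist μ n a = μ n (unitInv a) := by
  unfold invUnitsDist
  split_ifs with h
  · rw [unitInv_of_isUnit h]
  · rcases Nat.eq_zero_or_pos n with hn | hn
    · subst hn
      haveI : Subsingleton (ZMod (p ^ 0)) := ZMod.subsingleton_iff.mpr (pow_zero p)
      exact absurd (isUnit_of_subsingleton a) h
    · rw [unitInv_of_not_isUnit h, h0 n hn a h]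

/-- `σ` commutes with reduction `ℤ/p^{n+1} → ℤ/p^n`. [folklore] -/
private theorem castHom_unitInv (n : ℕ) (b : ZMod (p ^ (n + 1))) :
    ZMod.castHom (pow_dvd_pow p n.le_succ) (ZMod (p ^ n)) (unitInv b) =
      unitInv (ZMod.castHom (pow_dvd_pow p n.le_succ) (ZMod (p ^ n)) b) := by
  rcases Nat.eq_zero_or_pos n with hn | hn
  · subst hn
    haveI : Subsingleton (ZMod (p ^ 0)) := ZMod.subsingleton_iff.mpr (pow_zero p)
    exact Subsingleton.elim _ _
  · by_cases hb : IsUnit b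
    · have hcb : IsUnit (ZMod.castHom (pow_dvd_pow p n.le_succ) (ZMod (p ^ n)) b) :=
        (isUnit_iff_isUnit_castHom hn n.le_succ b).mp hb
      rw [unitInv_of_isUnit hb, unitInv_of_isUnit hcb]
      have h1 : ZMod.castHom (pow_dvd_pow p n.le_succ) (ZMod (p ^ n)) b *
          ZMod.castHom (pow_dvd_pow p n.le_succ) (ZMod (p ^ n))
            ((hb.unit⁻¹ : (ZMod (p ^ (n + 1)))ˣ) : ZMod (p ^ (n + 1))) = 1 := by
        rw [← map_mul, IsUnit.mul_val_inv, map_one]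
      have h2 : ZMod.castHom (pow_dvd_pow p n.le_succ) (ZMod (p ^ n)) b *
          ((hcb.unit⁻¹ : (ZMod (p ^ n))ˣ) : ZMod (p ^ n)) = 1 := IsUnit.mul_val_inv hcb
      rw [← ZMod.inv_eq_of_mul_eq_one _ _ _ h1, ← ZMod.inv_eq_of_mul_eq_one _ _ _ h2]
    · have hcb : ¬ IsUnit (ZMod.castHom (pow_dvd_pow p n.le_succ) (ZMod (p ^ n)) b) :=
        fun h ↦ hb ((isUnit_iff_isUnit_castHom hn n.le_succ b).mpr h)
      rw [unitInv_of_not_isUnit hb, unitInv_of_not_isUnit hcb]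

/-- **`μ̌` satisfies the distribution relation** when `μ` does and `μ` vanishes on the non-unit
classes of every positive level (so that `μ` is a measure on `ℤ_p^×` and `x ↦ x⁻¹` is a
homeomorphism of the support; Lang Ch. 4 §2).
[cite: LangCyclotomic1990, Ch. 4 §2 (operations on measures, PDF pp. 80–82)] -/
theorem invUnitsDist_distribution
    (hdist : ∀ (n : ℕ) (a : ZMod (p ^ n)),
      ∑ b ∈ Finset.univ.filter (fun b : ZMod (p ^ (n + 1)) ↦
        ZMod.castHom (pow_dvd_pow p n.le_succ) (ZMod (p ^ n)) b = a), μ (n + 1) b = μ n a)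
    (h0 : ∀ n : ℕ, 1 ≤ n → ∀ a : ZMod (p ^ n), ¬ IsUnit a → μ n a = 0)
    (n : ℕ) (a : ZMod (p ^ n)) :
    ∑ b ∈ Finset.univ.filter (fun b : ZMod (p ^ (n + 1)) ↦
        ZMod.castHom (pow_dvd_pow p n.le_succ) (ZMod (p ^ n)) b = a),
      invUnitsDist μ (n + 1) b = invUnitsDist μ n a := by
  haveI : NeZero (p ^ (n + 1)) := ⟨pow_ne_zero _ (Fact.out : p.Prime).ne_zero⟩
  simp_rw [invUnitsDist_eq_comp h0]
  rw [← hdist n (unitInv a)]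
  refine Finset.sum_nbij' unitInv unitInv ?_ ?_ (fun b _ ↦ unitInv_unitInv b)
    (fun b _ ↦ unitInv_unitInv b) (fun b _ ↦ rfl)
  · intro b hb
    simp only [Finset.mem_filter, Finset.mem_univ, true_and] at hb ⊢
    rw [castHom_unitInv, hb]
  · intro b hb
    simp only [Finset.mem_filter, Finset.mem_univ, true_and] at hb ⊢
    rw [castHom_unitInv, hb, unitInv_unitInv]

/-- **`μ̌` on the classes**: `μ̌(η γ^s) = μ(η⁻¹ γ^{-s})` modulo `p^{n+e₀}` — the hypothesis `hinv`
of `hasSum_coeff_mul_cyclotomicGenerator_inv_pow_sub_one_of_twist`.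
[cite: LangCyclotomic1990, Ch. 4 §2 (operations on measures, PDF pp. 80–82)] -/
theorem invUnitsDist_classMap (n : ℕ) (η : rootsOfUnity (torsionOrder p) ℤ_[p]) (s : ZMod (p ^ n)) :
    invUnitsDist μ (n + cyclotomicExponent p)
        (PadicInt.toZModPow (n + cyclotomicExponent p) ((η : ℤ_[p]ˣ) : ℤ_[p]) *
          (cyclotomicGenerator p : ZMod (p ^ (n + cyclotomicExponent p))) ^ s.val) =
      μ (n + cyclotomicExponent p)
        (PadicInt.toZModPow (n + cyclotomicExponent p)
            (((η⁻¹ : rootsOfUnity (torsionOrder p) ℤ_[p]) : ℤ_[p]ˣ) : ℤ_[p]) *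
          (cyclotomicGenerator p : ZMod (p ^ (n + cyclotomicExponent p))) ^ (-s).val) := by
  have hu := isUnit_classMap p n (η, s)
  unfold invUnitsDist
  rw [dif_pos hu]
  congr 1
  have h1 := classMap_inv_mul (p := p) n η s
  have h2 : ((hu.unit⁻¹ : (ZMod (p ^ (n + cyclotomicExponent p)))ˣ) : ZMod _) *
      (PadicInt.toZModPow (n + cyclotomicExponent p) ((η : ℤ_[p]ˣ) : ℤ_[p]) *
        (cyclotomicGenerator p : ZMod (p ^ (n + cyclotomicExponent p))) ^ s.val) = 1 :=
    IsUnit.val_inv_mul hu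
  rw [mul_comm] at h1 h2
  rw [← ZMod.inv_eq_of_mul_eq_one _ _ _ h1, ← ZMod.inv_eq_of_mul_eq_one _ _ _ h2]

end Literature.NumberTheory.EllipticCurves

end
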